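import Summits.NavierStokesRegularity.NavierStokesRegularity.Theorems.UnthreadedDoorNetFluxAnalyticRadialGauge
import Summits.NavierStokesRegularity.NavierStokesRegularity.Theorems.UnthreadedDoorIndicatrixCellCountNearCentreFibres
import HarnessLib

/-!
# Route `UnthreadedDoor`, crux `PoloidalLiouville` (stmt-NavierStokesRegularity-1222), WALL W1 — crux idea «indicatrix-bound» (ns-idea-14):
# the JOINT radial gauge — `(t, x) ↦ T t x − T t (x₀ + ‖x − x₀‖ • σ₀)` is jointly real-analytic off the centre line

Support file (theorems only; `--supports stmt-NavierStokesRegularity-1222 --as helper`).  The space-time version of the landed per-slice gauge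
lemmas of the height-head line (ARM A g5: `NetFlux.analyticOnNhd_sub_ray`, p682202; `NetFlux.analyticRadialGauge`, p682734): if the velocity is JOINTLY
real-analytic on an open time set `𝒯` times `ℝ³`, the potential `T` is `C¹` in space off the centre and linked to it by `curl (v t) = ∇(T t) × (· − x₀)`,
then the explicit radial gauge `(t, x) ↦ T t x − T t (x₀ + ‖x − x₀‖ • σ₀)` (`σ₀` a unit vector) is JOINTLY real-analytic on `𝒯 × (ℝ³ ∖ {x₀})`.
Proof = the g5 proof with the parameter `t` carried along: the gauge is the great-circle line integral of the tangential field
`W (t, u) = (‖u − x₀‖²)⁻¹ • ((u − x₀) × curl (v t) u)`, jointly analytic in `(t, u)` by `Indicatrix.analyticOnNhd_curl_uncurry_of_isOpen`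
(ns-qj-p1 g8), along the normalised-chord arc (independent of `t`); `NetFlux.analyticOnNhd_intervalIntegral_param` (p681656) with the parameter space
`ℝ × E3`; two base directions glued by `NetFlux.exists_unit_off_two_rays`.  Consumed by Λ-5 (`UnthreadedDoorIndicatrixAnalyticFrameOfAnalyticData`).
Nothing here is about Navier–Stokes; ⟨1222⟩, W1 and NS regularity stay OPEN.  ARM A `pub/ns-exp-scalarLiouville` g8.
-/

noncomputable section

-- the summit and its single sub-problem share the name (CONVENTIONS §1)
set_option linter.dupNamespace false

open Set Function Filter Topology InnerProductSpace MeasureTheory Metric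
open scoped RealInnerProductSpace ContDiff

namespace Summit.NavierStokesRegularity.NavierStokesRegularity.Theorems.PoloidalLiouville.Indicatrix

open Summit.NavierStokesRegularity.NavierStokesRegularity.Theorems.PoloidalLiouville.NetFlux
  (E3 segment_ne_zero_of_norm_eq sub_eq_integral_tangential exists_unit_off_two_rays analyticOnNhd_intervalIntegral_param)
open Literature.Analysis Literature.Analysis.FluidPDE

/-- The SPACE-TIME tangential field `W (t, u) = (‖u − x₀‖²)⁻¹ • ((u − x₀) × curl (v t) u)` is jointly `C^ω` at every `(t, u)` with `t ∈ 𝒯`,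
`u ≠ x₀`, when `uncurry v` is analytic on `𝒯 × ℝ³` (`𝒯` open). [folklore] -/
theorem contDiffAt_tangentialField_uncurry {v : ℝ → E3 → E3} {𝒯 : Set ℝ} (h𝒯 : IsOpen 𝒯)
    (hv : AnalyticOnNhd ℝ (uncurry v) (𝒯 ×ˢ (univ : Set E3))) (x₀ : E3) {t : ℝ} {u : E3} (ht : t ∈ 𝒯) (hu : u ≠ x₀) :
    ContDiffAt ℝ ω (fun q : ℝ × E3 => (‖q.2 - x₀‖ ^ 2)⁻¹ • cross (q.2 - x₀) (curl (v q.1) q.2)) (t, u) := by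
  have h1 : ContDiffAt ℝ ω (fun q : ℝ × E3 => (‖q.2 - x₀‖ ^ 2)⁻¹) (t, u) := by
    refine ((contDiffAt_snd.sub contDiffAt_const).norm_sq ℝ).inv ?_
    exact pow_ne_zero 2 (norm_ne_zero_iff.2 (sub_ne_zero.2 hu))
  have h2 : ContDiffAt ℝ ω (fun q : ℝ × E3 => crossCLM (q.2 - x₀)) (t, u) :=
    (crossCLM.contDiff.comp (contDiff_snd.sub contDiff_const)).contDiffAt
  have h3 : ContDiffAt ℝ ω (fun q : ℝ × E3 => curl (v q.1) q.2) (t, u) :=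
    (analyticOnNhd_curl_uncurry_of_isOpen h𝒯 hv (t, u) ⟨ht, mem_univ _⟩).contDiffAt
  have h4 : ContDiffAt ℝ ω (fun q : ℝ × E3 => crossCLM (q.2 - x₀) (curl (v q.1) q.2)) (t, u) := h2.clm_apply h3
  exact h1.smul h4

/-- **Great-circle representation, space-time version.**  Under the hypotheses of `contDiffAt_tangentialField_uncurry`, with `T t ∈ C¹(ℝ³ ∖ {x₀})`
linked to `v t` for `t ∈ 𝒯` and `σ` a unit vector, `(t, x) ↦ T t x − T t (x₀ + ‖x − x₀‖ • σ)` is jointly real-analytic on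
`𝒯 × {‖x − x₀‖ • σ + (x − x₀) ≠ 0}` (off the closed ray antipodal to `σ`). [folklore] -/
theorem analyticOnNhd_sub_ray_uncurry {v : ℝ → E3 → E3} {T : ℝ → E3 → ℝ} {x₀ σ : E3} {𝒯 : Set ℝ} (h𝒯 : IsOpen 𝒯)
    (hv : AnalyticOnNhd ℝ (uncurry v) (𝒯 ×ˢ (univ : Set E3)))
    (hT : ∀ t ∈ 𝒯, ContDiffOn ℝ 1 (T t) ({x₀}ᶜ : Set E3))
    (hω : ∀ t ∈ 𝒯, ∀ x, curl (v t) x = cross (gradient (T t) x) (x - x₀)) (hσ : ‖σ‖ = 1) :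
    AnalyticOnNhd ℝ (fun z : ℝ × E3 => T z.1 z.2 - T z.1 (x₀ + ‖z.2 - x₀‖ • σ))
      (𝒯 ×ˢ {x : E3 | ‖x - x₀‖ • σ + (x - x₀) ≠ 0}) := by
  set Ω : Set E3 := {x : E3 | ‖x - x₀‖ • σ + (x - x₀) ≠ 0} with hΩ
  have hΩo : IsOpen Ω := isOpen_ne_fun (by fun_prop) continuous_const
  have hDo : IsOpen (𝒯 ×ˢ Ω) := h𝒯.prod hΩo
  have hy0 : ∀ x ∈ Ω, x - x₀ ≠ 0 := by
    intro x hx h0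
    apply hx
    simp [h0]
  have hnu : ∀ x : E3, ‖‖x - x₀‖ • σ‖ = ‖x - x₀‖ := fun x => by
    rw [norm_smul, norm_norm, hσ, mul_one]
  -- the interpolating chord and its normalisation (independent of `t`)
  set N : ℝ × E3 → E3 := fun z => ‖z.2 - x₀‖ • σ + z.1 • ((z.2 - x₀) - ‖z.2 - x₀‖ • σ) with hN
  set Ψ : ℝ × E3 → E3 := fun z => x₀ + (‖z.2 - x₀‖ * ‖N z‖⁻¹) • N z with hΨ
  have hN0 : ∀ (s : ℝ), ∀ x ∈ Ω, N (s, x) ≠ 0 := fun s x hx =>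
    segment_ne_zero_of_norm_eq (hnu x) hx s
  have hΨsph : ∀ (s : ℝ), ∀ x ∈ Ω, ‖Ψ (s, x) - x₀‖ = ‖x - x₀‖ := by
    intro s x hx
    simp only [hΨ, add_sub_cancel_left, norm_smul, norm_mul, norm_norm, norm_inv]
    rw [mul_assoc, inv_mul_cancel₀ (norm_ne_zero_iff.2 (hN0 s x hx)), mul_one]
  have hΨ0 : ∀ x ∈ Ω, Ψ (0, x) = x₀ + ‖x - x₀‖ • σ := by
    intro x hx
    have h1 : N (0, x) = ‖x - x₀‖ • σ := by simp [hN]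
    simp only [hΨ, h1, hnu]
    rw [mul_inv_cancel₀ (norm_ne_zero_iff.2 (hy0 x hx)), one_smul]
  have hΨ1 : ∀ x ∈ Ω, Ψ (1, x) = x := by
    intro x hx
    have h1 : N (1, x) = x - x₀ := by simp [hN]
    simp only [hΨ, h1]
    rw [mul_inv_cancel₀ (norm_ne_zero_iff.2 (hy0 x hx)), one_smul, add_sub_cancel]
  have hΨne : ∀ (s : ℝ), ∀ x ∈ Ω, Ψ (s, x) ≠ x₀ := by
    intro s x hx h
    have := hΨsph s x hx
    rw [h, sub_self, norm_zero] at this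
    exact hy0 x hx (norm_eq_zero.1 this.symm)
  -- joint real-analyticity of the chord family in `(s, x)`
  have hΨc : ∀ (s : ℝ), ∀ x ∈ Ω, ContDiffAt ℝ ω Ψ (s, x) := by
    intro s x hx
    have hy : ContDiffAt ℝ ω (fun z : ℝ × E3 => z.2 - x₀) (s, x) := contDiffAt_snd.sub contDiffAt_const
    have hn : ContDiffAt ℝ ω (fun z : ℝ × E3 => ‖z.2 - x₀‖) (s, x) := hy.norm ℝ (hy0 x hx)
    have hNc : ContDiffAt ℝ ω N (s, x) :=
      (hn.smul contDiffAt_const).add (contDiffAt_fst.smul (hy.sub (hn.smul contDiffAt_const)))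
    have hNn : ContDiffAt ℝ ω (fun z => ‖N z‖⁻¹) (s, x) :=
      (hNc.norm ℝ (hN0 s x hx)).inv (norm_ne_zero_iff.2 (hN0 s x hx))
    exact contDiffAt_const.add ((hn.mul hNn).smul hNc)
  -- the space-time tangential field and the integrand on the parameter space `ℝ × E3`
  set W : ℝ × E3 → E3 := fun q => (‖q.2 - x₀‖ ^ 2)⁻¹ • cross (q.2 - x₀) (curl (v q.1) q.2) with hW
  set Fi : ℝ → ℝ × E3 → ℝ := fun s p => ⟪W (p.1, Ψ (s, p.2)), fderiv ℝ Ψ (s, p.2) (1, 0)⟫ with hFi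
  have hFa : ∀ s ∈ uIcc (0 : ℝ) 1, ∀ p ∈ 𝒯 ×ˢ Ω, AnalyticAt ℝ (fun w : ℝ × (ℝ × E3) => Fi w.1 w.2) (s, p) := by
    rintro s - ⟨t, x⟩ ⟨ht, hx⟩
    -- the projections `(s, (t, x)) ↦ (s, x)` and `(s, (t, x)) ↦ t`
    have hπ : ContDiffAt ℝ ω (fun w : ℝ × (ℝ × E3) => ((w.1, w.2.2) : ℝ × E3)) (s, (t, x)) :=
      contDiffAt_fst.prodMk (contDiffAt_snd.comp _ contDiffAt_snd)
    have hΨw : ContDiffAt ℝ ω (fun w : ℝ × (ℝ × E3) => Ψ (w.1, w.2.2)) (s, (t, x)) :=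
      ContDiffAt.comp (s, (t, x)) (g := Ψ) (f := fun w : ℝ × (ℝ × E3) => ((w.1, w.2.2) : ℝ × E3)) (hΨc s x hx) hπ
    have h1 : ContDiffAt ℝ ω (fun w : ℝ × (ℝ × E3) => W (w.2.1, Ψ (w.1, w.2.2))) (s, (t, x)) := by
      have hq : ContDiffAt ℝ ω (fun w : ℝ × (ℝ × E3) => ((w.2.1, Ψ (w.1, w.2.2)) : ℝ × E3)) (s, (t, x)) :=
        (contDiffAt_fst.comp _ contDiffAt_snd).prodMk hΨw
      exact ContDiffAt.comp (s, (t, x)) (g := W) (f := fun w : ℝ × (ℝ × E3) => ((w.2.1, Ψ (w.1, w.2.2)) : ℝ × E3))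
        (contDiffAt_tangentialField_uncurry h𝒯 hv x₀ ht (hΨne s x hx)) hq
    have h2 : ContDiffAt ℝ ω (fun w : ℝ × (ℝ × E3) => fderiv ℝ Ψ (w.1, w.2.2) ((1 : ℝ), (0 : E3))) (s, (t, x)) :=
      (ContDiffAt.comp (s, (t, x)) (g := fderiv ℝ Ψ) (f := fun w : ℝ × (ℝ × E3) => ((w.1, w.2.2) : ℝ × E3))
        ((hΨc s x hx).fderiv_right le_top) hπ).clm_apply contDiffAt_const
    have h3 : ContDiffAt ℝ ω (fun w : ℝ × (ℝ × E3) =>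
        ⟪W (w.2.1, Ψ (w.1, w.2.2)), fderiv ℝ Ψ (w.1, w.2.2) ((1 : ℝ), (0 : E3))⟫) (s, (t, x)) :=
      h1.inner ℝ h2
    have h4 : (fun w : ℝ × (ℝ × E3) => Fi w.1 w.2) =
        fun w : ℝ × (ℝ × E3) => ⟪W (w.2.1, Ψ (w.1, w.2.2)), fderiv ℝ Ψ (w.1, w.2.2) ((1 : ℝ), (0 : E3))⟫ := by
      funext w
      simp only [hFi]
    rw [h4]
    exact h3.analyticAt
  have hI : AnalyticOnNhd ℝ (fun p : ℝ × E3 => ∫ s in (0 : ℝ)..1, Fi s p) (𝒯 ×ˢ Ω) :=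
    analyticOnNhd_intervalIntegral_param hDo hFa
  -- identification with the re-gauged potential on `𝒯 × Ω`
  intro p hp
  refine (hI p hp).congr (eventuallyEq_of_mem (hDo.mem_nhds hp) fun p' hp' => ?_)
  obtain ⟨t', x'⟩ := p'
  obtain ⟨ht', hx'⟩ := hp'
  have hd : ∀ s, HasDerivAt (fun r : ℝ => Ψ (r, x')) (fderiv ℝ Ψ (s, x') ((1 : ℝ), (0 : E3))) s := by
    intro s
    have h1 : HasFDerivAt Ψ (fderiv ℝ Ψ (s, x')) (s, x') :=
      ((hΨc s x' hx').differentiableAt (by simp)).hasFDerivAt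
    have h2 : HasDerivAt (fun r : ℝ => ((r, x') : ℝ × E3)) ((1 : ℝ), (0 : E3)) s :=
      (hasDerivAt_id s).prodMk (hasDerivAt_const s x')
    exact h1.comp_hasDerivAt s h2
  have hc' : Continuous fun s : ℝ => fderiv ℝ Ψ (s, x') ((1 : ℝ), (0 : E3)) := by
    refine continuous_iff_continuousAt.2 fun s => ?_
    have h1 : ContinuousAt (fderiv ℝ Ψ) (s, x') :=
      ((hΨc s x' hx').fderiv_right (m := ω) le_top).continuousAt
    have h2 : ContinuousAt (fun r : ℝ => ((r, x') : ℝ × E3)) s := by fun_prop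
    exact ((ContinuousAt.comp (f := fun r : ℝ => ((r, x') : ℝ × E3)) h1 h2).clm_apply
      continuousAt_const)
  have key := sub_eq_integral_tangential (hT t' ht') (hω t' ht') (γ := fun r => Ψ (r, x'))
    (γ' := fun s => fderiv ℝ Ψ (s, x') ((1 : ℝ), (0 : E3))) (norm_pos_iff.2 (hy0 x' hx'))
    (fun s => hΨsph s x' hx') hd hc'
  simp only [hΨ1 x' hx', hΨ0 x' hx'] at key
  simpa [hFi, hW] using key.symm

/-- ★ **The JOINT radial gauge is real-analytic off the centre line.**  `𝒯` open, `uncurry v` real-analytic on `𝒯 × ℝ³`, `uncurry T` smooth on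
`𝒯 × (ℝ³ ∖ {x₀})`, `curl (v t) = ∇(T t) × (· − x₀)` for `t ∈ 𝒯`, `σ₀` a unit vector: then
`uncurry (fun t x => T t x − T t (x₀ + ‖x − x₀‖ • σ₀))` is real-analytic on `𝒯 × (ℝ³ ∖ {x₀})` (two base directions glued, as in
`NetFlux.analyticRadialGauge`). [folklore] -/
theorem analyticOnNhd_radialGauge_uncurry {v : ℝ → E3 → E3} {T : ℝ → E3 → ℝ} {x₀ σ₀ : E3} {𝒯 : Set ℝ} (h𝒯 : IsOpen 𝒯)
    (hσ₀ : ‖σ₀‖ = 1) (hv : AnalyticOnNhd ℝ (uncurry v) (𝒯 ×ˢ (univ : Set E3)))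
    (hT : ContDiffOn ℝ (⊤ : ℕ∞) (uncurry T) (𝒯 ×ˢ ({x₀}ᶜ : Set E3)))
    (hω : ∀ t ∈ 𝒯, ∀ x, curl (v t) x = cross (gradient (T t) x) (x - x₀)) :
    AnalyticOnNhd ℝ (uncurry fun t x => T t x - T t (x₀ + ‖x - x₀‖ • σ₀)) (𝒯 ×ˢ ({x₀}ᶜ : Set E3)) := by
  have hT1 : ∀ t ∈ 𝒯, ContDiffOn ℝ 1 (T t) ({x₀}ᶜ : Set E3) := fun t ht => by
    have h : ContDiffOn ℝ (⊤ : ℕ∞) (uncurry T ∘ fun x : E3 => (t, x)) ({x₀}ᶜ : Set E3) :=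
      hT.comp (contDiff_prodMk_right t).contDiffOn fun x hx => ⟨ht, hx⟩
    exact h.of_le (by exact_mod_cast le_top)
  rintro ⟨t₁, x₁⟩ ⟨ht₁, hx₁⟩
  have hx₁' : x₁ ≠ x₀ := hx₁
  have hy₁ : x₁ - x₀ ≠ 0 := sub_ne_zero.2 hx₁'
  have hn₁ : ‖x₁ - x₀‖ ≠ 0 := norm_ne_zero_iff.2 hy₁
  obtain ⟨σ₁, hσ₁, hsum, hΩ₁⟩ := exists_unit_off_two_rays σ₀ hy₁
  -- the ray point `x₀ + ‖y₁‖ σ₁` lies off the antipodal ray of `σ₀`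
  set p₁ : E3 := x₀ + ‖x₁ - x₀‖ • σ₁ with hp₁
  have hp₁Ω : ‖p₁ - x₀‖ • σ₀ + (p₁ - x₀) ≠ 0 := by
    have h1 : p₁ - x₀ = ‖x₁ - x₀‖ • σ₁ := by simp [hp₁]
    rw [h1, norm_smul, norm_norm, hσ₁, mul_one, ← smul_add]
    exact smul_ne_zero hn₁ hsum
  -- the three analytic pieces
  have hA := analyticOnNhd_sub_ray_uncurry h𝒯 hv hT1 hω hσ₁ (t₁, x₁) ⟨ht₁, hΩ₁⟩
  have hB := analyticOnNhd_sub_ray_uncurry h𝒯 hv hT1 hω hσ₀ (t₁, p₁) ⟨ht₁, hp₁Ω⟩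
  have hC : AnalyticAt ℝ (fun z : ℝ × E3 => ((z.1, x₀ + ‖z.2 - x₀‖ • σ₁) : ℝ × E3)) (t₁, x₁) :=
    (contDiffAt_fst.prodMk (contDiffAt_const.add
      (((contDiffAt_snd.sub contDiffAt_const).norm ℝ hy₁).smul contDiffAt_const))).analyticAt
  have hBC := AnalyticAt.comp (g := fun z : ℝ × E3 => T z.1 z.2 - T z.1 (x₀ + ‖z.2 - x₀‖ • σ₀))
    (f := fun z : ℝ × E3 => ((z.1, x₀ + ‖z.2 - x₀‖ • σ₁) : ℝ × E3)) hB hC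
  refine (hA.add hBC).congr (Eventually.of_forall fun z => ?_)
  simp only [Pi.add_apply, comp_apply, uncurry, add_sub_cancel_left, norm_smul, norm_norm, hσ₁, mul_one]
  ring

end Summit.NavierStokesRegularity.NavierStokesRegularity.Theorems.PoloidalLiouville.Indicatrix

end
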